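import Literature.NumberTheory.EllipticCurves.MultiplicativeTransvectionPrimeToVProofs
import HarnessLib

/-!
# Pointwise-rational `p`-torsion at a multiplicative place `v ∤ p` forces `p ∣ ord_v(Δ_min)`
# (Silverman *ATAEC* V.6 Prop. 6.1 / Ex. 5.13 (b), contrapositive); the valuation half of
# [IUTchI] Example 3.2 (iv) "`q_v` admits a `2l`-th root"

`Proofs` file (theorems only: no definition, no named fact), topic `NumberTheory/EllipticCurves`;
immediate consequences of the tree's number-field transvection theorem
`WeierstrassCurve.exists_transvection_geomTorsion_of_hasMultiplicativeReductionAt_of_not_dvd`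
(`MultiplicativeTransvectionPrimeToVProofs`: `E/K` over a number field, `v` multiplicative, `p` prime,
`v ∤ p`, `p ∤ ord_v(Δ_min)` ⟹ some `σ ∈ Γ_K` MOVES a point of `E[p] = E(K̄)[p]`).

J. H. Silverman, *Advanced Topics in the Arithmetic of Elliptic Curves*, GTM 151 (1994), V.6
Prop. 6.1 (p. 410) and Exercise 5.13 (b): over the completion at a multiplicative place the inertia
group acts on `E[p] ≅ ⟨ζ_p, q^{1/p}⟩` through `(1 ord_v(q); 0 1)`, so it acts trivially iff
`p ∣ ord_v(q) = ord_v(Δ_min)`.  Read CONTRAPOSITIVELY and globally: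

* `dvd_ordMinimalDiscriminant_of_forall_smul_geomTorsion_eq` — if EVERY `σ ∈ Γ_K` fixes EVERY point of
  `E[p]` (the `p`-torsion is pointwise `K`-rational in the Galois sense), then `p ∣ ord_v(Δ_min)` at
  every place `v ∤ p` of multiplicative reduction;
* `mul_dvd_ordMinimalDiscriminant_of_forall_smul_geomTorsion_eq` — two distinct primes `p ≠ p′`, both
  with pointwise-rational torsion and `v ∤ p p′`: `p·p′ ∣ ord_v(Δ_min)`;
* `two_mul_dvd_ordMinimalDiscriminant_of_forall_smul_geomTorsion_eq` — the case `(2, l)`, `l` an odd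
  prime: `2l ∣ ord_v(Δ_min)`.

Consumer (cell abc-iut; the locator records WHERE it is used, the mathematics is classical and
undisputed): [IUTchI] Example 3.2 (iv), kurims manuscript (May 2020) p. 71 — "Write `q_v` for the
`q`-parameter of the elliptic curve `E_v` over `K_v` … it follows from our assumption concerning
`2`-torsion [cf. Definition 3.1, (b): "the `2·3`-torsion points of `E_F` are rational over `F`",
p. 62], together with the definition of “`K`” [cf. Definition 3.1, (c): `K = F(E_F[l])`], that `q_v`
admits a `2l`-th root in `𝒪^▷(T_{X̲̲_v}) (≅ 𝒪^▷_{K_v})`."  At the level of VALUATIONS this says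
`2l ∣ ord_v(q_v) = ord_v(Δ_min(E_K))` at the places `v ∈ 𝕍(K)^bad` (odd residue characteristic
`≠ l`, Def. 3.1 (b)(c)) — which is the last theorem applied to `E_K := E_F ⊗_F K` (the `2`- and
`l`-torsion of `E_K` being pointwise `Γ_K`-invariant).  The valuation statement is what the
Cor. 3.12 provenance clause (hbadD) of `Summits/ABC/IUTFork/Cor312ProvenanceFramesDegree.lean`
reads (the log-volume of the `q`-centre depends only on its norm); the ROOT itself (the unit part of
`q_v` being a `2l`-th power) needs Tate's uniformisation (the tree's named fact
`Literature.NumberTheory.EllipticCurves.TateCurve.uniformization`) and is NOT addressed here.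
Deliberately NOT here either: the bridge from abc-iut-L5-t2's `InitialThetaData` (its fields
`torsion_six_rational`, `range_K_iff` over an abstract algebraic closure `Fbar`) to the hypotheses
below (stated over Mathlib's `Field.absoluteGaloisGroup K` / the tree's `geomTorsion`), and the
base change of multiplicative reduction `E_F ↝ E_K` — both interface plumbing owned by layer L5.

## References
* [SilvermanATAEC1994] J. H. Silverman, GTM 151 (1994), V.6 Prop. 6.1 (p. 410), Exercise 5.13 (b).
* [SerreInventiones1972] J.-P. Serre, Invent. Math. 15 (1972), §1.12 (the Tate-curve inertia action).
* [Mochizuki2012] S. Mochizuki, *Inter-universal Teichmüller theory I*, kurims manuscript (May 2020),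
  Def. 3.1 (b)(c) pp. 61–62, Example 3.2 (iv) p. 71 (consumer locus only).
-/

noncomputable section

open scoped Classical
open NumberField IsDedekindDomain

universe u

namespace WeierstrassCurve

open Literature.NumberTheory.EllipticCurves Literature.NumberTheory.GaloisRepresentations Field

variable {K : Type u} [Field K] [NumberField K] {v : HeightOneSpectrum (𝓞 K)}
  (W : WeierstrassCurve K)

/-- **Pointwise-rational `p`-torsion forces `p ∣ ord_v(Δ_min)` at a multiplicative place `v ∤ p`**
(Silverman *ATAEC* V.6 Prop. 6.1 / Ex. 5.13 (b), contrapositive of the tree's transvection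
theorem): for `E/K` elliptic over a number field, `v` a finite place of multiplicative reduction, `p`
a prime with `v ∤ p`, if every `σ ∈ Γ_K` fixes every `Q ∈ E[p]` then `p ∣ ord_v(Δ_min)`.
[cite: SilvermanATAEC1994, V.6 Prop. 6.1 (p. 410)] [cite: SerreInventiones1972, §1.12] -/
theorem dvd_ordMinimalDiscriminant_of_forall_smul_geomTorsion_eq [W.IsElliptic]
    (hmult : W.HasMultiplicativeReductionAt v) {p : ℕ} (hp : p.Prime)
    (hpv : (p : 𝓞 K) ∉ v.asIdeal)
    (hfix : ∀ (σ : absoluteGaloisGroup K) (Q : geomTorsion W (p : ℤ)), σ • Q = Q) :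
    p ∣ W.ordMinimalDiscriminant v := by
  by_contra hndvd
  obtain ⟨σ, -, Q, hQ⟩ :=
    W.exists_transvection_geomTorsion_of_hasMultiplicativeReductionAt_of_not_dvd hmult hp hpv hndvd
  exact hQ (hfix σ Q)

/-- **Two primes with pointwise-rational torsion**: `p ≠ p′` primes, `v ∤ p`, `v ∤ p′`, `v`
multiplicative, `Γ_K` fixing `E[p]` and `E[p′]` pointwise ⟹ `p·p′ ∣ ord_v(Δ_min)`.
[cite: SilvermanATAEC1994, V.6 Prop. 6.1 (p. 410)] -/
theorem mul_dvd_ordMinimalDiscriminant_of_forall_smul_geomTorsion_eq [W.IsElliptic]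
    (hmult : W.HasMultiplicativeReductionAt v) {p p' : ℕ} (hp : p.Prime) (hp' : p'.Prime)
    (hne : p ≠ p') (hpv : (p : 𝓞 K) ∉ v.asIdeal) (hp'v : (p' : 𝓞 K) ∉ v.asIdeal)
    (hfix : ∀ (σ : absoluteGaloisGroup K) (Q : geomTorsion W (p : ℤ)), σ • Q = Q)
    (hfix' : ∀ (σ : absoluteGaloisGroup K) (Q : geomTorsion W (p' : ℤ)), σ • Q = Q) :
    p * p' ∣ W.ordMinimalDiscriminant v :=
  Nat.Coprime.mul_dvd_of_dvd_of_dvd ((Nat.coprime_primes hp hp').mpr hne)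
    (W.dvd_ordMinimalDiscriminant_of_forall_smul_geomTorsion_eq hmult hp hpv hfix)
    (W.dvd_ordMinimalDiscriminant_of_forall_smul_geomTorsion_eq hmult hp' hp'v hfix')

/-- **The valuation half of [IUTchI] Example 3.2 (iv)** ("`q_v` admits a `2l`-th root in `𝒪^▷_{K_v}`",
kurims p. 71, from Def. 3.1 (b) "`2·3`-torsion rational" and (c) "`K = F(E_F[l])`"), as classical
number theory: for `E/K` elliptic over a number field whose `2`-torsion and `l`-torsion (`l` an odd
prime) are fixed pointwise by `Γ_K`, at every place `v` of multiplicative reduction with `v ∤ 2`,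
`v ∤ l` one has `2l ∣ ord_v(Δ_min) (= ord_v(q_v))`.  (The root itself needs Tate uniformisation and
is not claimed.) [cite: SilvermanATAEC1994, V.6 Prop. 6.1 (p. 410)]
[cite: Mochizuki2012, IUTchI Ex. 3.2 (iv) p.71] -/
theorem two_mul_dvd_ordMinimalDiscriminant_of_forall_smul_geomTorsion_eq [W.IsElliptic]
    (hmult : W.HasMultiplicativeReductionAt v) {l : ℕ} (hl : l.Prime) (hl2 : l ≠ 2)
    (h2v : (2 : 𝓞 K) ∉ v.asIdeal) (hlv : (l : 𝓞 K) ∉ v.asIdeal)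
    (hfix2 : ∀ (σ : absoluteGaloisGroup K) (Q : geomTorsion W (2 : ℤ)), σ • Q = Q)
    (hfixl : ∀ (σ : absoluteGaloisGroup K) (Q : geomTorsion W (l : ℤ)), σ • Q = Q) :
    2 * l ∣ W.ordMinimalDiscriminant v :=
  W.mul_dvd_ordMinimalDiscriminant_of_forall_smul_geomTorsion_eq hmult Nat.prime_two hl
    (Ne.symm hl2) (by exact_mod_cast h2v) hlv (by exact_mod_cast hfix2) hfixl

end WeierstrassCurve

end
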